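import Mathlib.Analysis.SpecialFunctions.ImproperIntegrals
import Literature.NumberTheory.LFunctions.WeilWindowSimpleEven
import Literature.NumberTheory.LFunctions.WeilArchimedeanPositivityProofs
import Literature.NumberTheory.LFunctions.WeilMellinBounds
import Literature.NumberTheory.LFunctions.WeilArchimedeanMoments
import Literature.NumberTheory.LFunctions.WeilExplicitRightEdge
import Literature.Analysis.SpecialFunctions.DigammaLogBound
import Summits.RiemannHypothesis.RiemannHypothesis.Theorems.SpectralTraceWindowTraceArchStubDomination
import Summits.RiemannHypothesis.RiemannHypothesis.Theorems.SpectralTraceWindowTraceArchStubDenseFamily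
import HarnessLib

/-!
# Exactness on a dense family of window tests extends to the window (`stub_extensionOfDense`)

Stub `stub_extensionOfDense` of the line `defect-compactness-design` for the crux `WindowTraceArch`
(stmt-RiemannHypothesis-11195; skeleton
`Summit.RiemannHypothesis.RiemannHypothesis.Cruxes.WindowTraceArch.DefectCompactnessDesign`).

**Statement.** Assume the domination lemma of the line (the statement of `stub_domination`, taken
here as a hypothesis): along a configuration `x : ℕ → ℝ` with a polynomial local count profile and
inside a displacement budget `D` there are `K, k` such that the transform `ĥ(1/2 + i(x n + v))`
(`|v| ≤ D`) of every Weil test `h` is dominated by a summable sequence of total mass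
`≤ K (∫ ‖h‖ + ∫ ‖h^{(k)}‖)`. Let `g j` (`j ∈ ℕ`) be a family of Weil tests supported in the closed
window `K = [-log 2, log 2]` which is dense, in every `C^k` sup-seminorm, among the Weil tests
supported in `K`; let `x` be a poly-profile configuration, `δ` a displacement with `|δ n| ≤ D`, and
suppose the unit-atomic family `n ↦ x n + δ n` reproduces the Weil functional `W(g j)` exactly
(`HasSum`) for every `j`. Then it reproduces `W(f)` for EVERY Weil test `f` supported in `K`.

**Proof sketch.** Both sides are continuous in `f` for the `C^k` sup-seminorms on `𝒟_K`.
Put `h = f - g j`, a Weil test supported in `K`, and `L(u) = ∑ₙ û(1/2 + i(x n + δ n))`.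
* Spectral side: by domination `L(h)` converges absolutely and
  `‖L(h)‖ ≤ |K| (∫ ‖h‖ + ∫ ‖h^{(k)}‖) ≤ |K| · 4 log 2 · ε` as soon as `sup ‖h^{(i)}‖ ≤ ε` for
  `i ≤ k` (all derivatives of `h` vanish outside `K`); and `L(f) = L(h) + L(g j)` (`weilMellin_add`).
* Weil side: `W(f) = W(h) + W(g j)` (`weilFunctional_add`), and for a Weil test `h` supported in
  `K` the prime term vanishes (`weilPrimeTerm_eq_zero_of_tsupport_subset`), so
  `W(h) = ĥ(0) + ĥ(1) + (1/2π) ∫ ĥ(1/2 + it) Re ψ(1/4 + it/2) dt - h(0) log π` with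
  `‖ĥ(0)‖, ‖ĥ(1)‖ ≤ ∫ ‖h‖ e^{|t|/2} ≤ 2 · 2 log 2 · ε` (`norm_weilMellin_le_weilL1`),
  `‖ĥ(1/2 + it)‖ ≤ 8 (∫ ‖h‖ + ∫ ‖h'''‖)/(1 + |t|)³` (three integrations by parts,
  `stub_domination_decay`), `|Re ψ(1/4 + it/2)| ≤ C_ψ + log(1 + |t|) ≤ (|C_ψ| + 1)(1 + |t|)`
  (`exists_norm_digamma_vertical_le`), whence `‖∫ …‖ ≤ 8 (|C_ψ| + 1) π (∫ ‖h‖ + ∫ ‖h'''‖)`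
  (`∫ (1 + t²)⁻¹ = π`), and `‖h(0)‖ log π ≤ ε log π`. Altogether `‖W(h)‖ ≤ c ε`.
* Since `L(g j) = W(g j)`, `‖L(f) - W(f)‖ = ‖L(h) - W(h)‖ ≤ (|K| · 4 log 2 + c) ε` for every
  `ε > 0` (density with `max k 3` derivatives), so `L(f) = W(f)`; the series being absolutely
  convergent (domination of `f` itself), this is a `HasSum`.

**Sources.** Standard distribution-theory continuity argument (a functional continuous for the
`C^k` sup-seminorms on `𝒟_K` is determined by its values on a dense family; e.g. L. Schwartz,
*Théorie des distributions* (1966), Ch. III §1–§3) combined with the elementary estimates of the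
Weil explicit formula's archimedean term (H. Iwaniec, E. Kowalski, *Analytic Number Theory* (2004),
Thm 5.12 and (5.44)–(5.45)). All ingredients are proved tree / Mathlib facts. [folklore]
-/

set_option linter.dupNamespace false

noncomputable section

open Complex Filter Set MeasureTheory
open scoped Real Topology BigOperators

namespace Summit.RiemannHypothesis.RiemannHypothesis.Theorems.SpectralTraceWindowTraceArch

open Literature.NumberTheory.LFunctions

/-! ## Integrals of functions supported in a compact interval -/

/-- A nonnegative function bounded by `M` on `[a, b]` and vanishing off `[a, b]` has integral
`≤ M (b - a)` (whether or not it is integrable). [folklore] -/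
theorem stub_extensionOfDense_integral_le {F : ℝ → ℝ} {M a b : ℝ} (hab : a ≤ b)
    (hF0 : ∀ t, 0 ≤ F t) (hFM : ∀ t ∈ Set.Icc a b, F t ≤ M) (hF : ∀ t ∉ Set.Icc a b, F t = 0) :
    ∫ t, F t ≤ M * (b - a) := by
  have hle : ∀ t, F t ≤ (Set.Icc a b).indicator (fun _ => M) t := by
    intro t
    by_cases ht : t ∈ Set.Icc a b
    · rw [Set.indicator_of_mem ht]
      exact hFM t ht
    · rw [Set.indicator_of_notMem ht, hF t ht]
  have hint : Integrable ((Set.Icc a b).indicator fun _ : ℝ => M) :=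
    (integrableOn_const (μ := volume) (s := Set.Icc a b) (C := M)
      (by rw [Real.volume_Icc]; exact ENNReal.ofReal_ne_top)).integrable_indicator
      measurableSet_Icc
  calc ∫ t, F t ≤ ∫ t, (Set.Icc a b).indicator (fun _ => M) t :=
        integral_mono_of_nonneg (Eventually.of_forall hF0) hint (Eventually.of_forall hle)
    _ = M * (b - a) := by
        rw [integral_indicator_const _ measurableSet_Icc, Real.volume_real_Icc_of_le hab,
          smul_eq_mul]
        ring

/-- For `h` supported in the closed window `[-log 2, log 2]` with `sup ‖h^{(i)}‖ ≤ ε`: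
`∫ ‖h^{(i)}‖ ≤ ε · 2 log 2` (the derivative vanishes off the window). [folklore] -/
theorem stub_extensionOfDense_integral_iteratedDeriv_le {h : ℝ → ℂ}
    (hhK : tsupport h ⊆ Set.Icc (-Real.log 2) (Real.log 2)) {i : ℕ} {ε : ℝ}
    (hε : ∀ t, ‖iteratedDeriv i h t‖ ≤ ε) :
    ∫ t, ‖iteratedDeriv i h t‖ ≤ ε * (2 * Real.log 2) := by
  have hlog : -Real.log 2 ≤ Real.log 2 := by
    have := Real.log_pos one_lt_two
    linarith
  have h := stub_extensionOfDense_integral_le hlog (fun t => norm_nonneg (iteratedDeriv i h t))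
    (fun t _ => hε t)
    (fun t ht => by rw [stub_denseFamily_iteratedDeriv_eq_zero hhK i ht, norm_zero])
  have e : Real.log 2 - -Real.log 2 = 2 * Real.log 2 := by ring
  rwa [e] at h

/-! ## The Weil side is small on small window tests -/

/-- The archimedean integral of a Weil test is controlled by `∫ ‖h‖ + ∫ ‖h'''‖`:
`‖∫ ĥ(1/2 + it) Re ψ(1/4 + it/2) dt‖ ≤ 8 (|C_ψ| + 1) π (∫ ‖h‖ + ∫ ‖h'''‖)`, where
`‖ψ(1/4 + iy)‖ ≤ C_ψ + log(1 + |y|)`. [folklore] -/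
theorem stub_extensionOfDense_norm_weilArchIntegral_le {Cψ : ℝ}
    (hCψ : ∀ y : ℝ, ‖Complex.digamma ((1 / 4 : ℝ) + y * I)‖ ≤ Cψ + Real.log (1 + |y|))
    {h : ℝ → ℂ} (hh : IsWeilTest h) :
    ‖weilArchIntegral h‖ ≤
      8 * (|Cψ| + 1) * π * ((∫ t, ‖h t‖) + ∫ t, ‖iteratedDeriv 3 h t‖) := by
  set S : ℝ := (∫ t, ‖h t‖) + ∫ t, ‖iteratedDeriv 3 h t‖ with hS
  have hS0 : 0 ≤ S :=
    add_nonneg (integral_nonneg fun _ => norm_nonneg _) (integral_nonneg fun _ => norm_nonneg _)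
  have hw : ∀ t : ℝ, (1 / 4 : ℂ) + (t : ℂ) / 2 * I = ((1 / 4 : ℝ) : ℂ) + ((t / 2 : ℝ) : ℂ) * I := by
    intro t
    push_cast
    ring
  have hbound : ∀ t : ℝ,
      ‖weilMellin h (1 / 2 + t * I) * ((Complex.digamma (1 / 4 + t / 2 * I)).re : ℂ)‖ ≤
        8 * S * (|Cψ| + 1) * (1 + t ^ 2)⁻¹ := by
    intro t
    rw [norm_mul]
    have h1 : ‖weilMellin h (1 / 2 + t * I)‖ ≤ 2 ^ 3 * S * ((1 + |t|) ^ 3)⁻¹ :=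
      stub_domination_decay hh 3 t
    have h2 : ‖((Complex.digamma (1 / 4 + t / 2 * I)).re : ℂ)‖ ≤ (|Cψ| + 1) * (1 + |t|) := by
      rw [Complex.norm_real, Real.norm_eq_abs]
      refine (Complex.abs_re_le_norm _).trans ?_
      have h3 := hCψ (t / 2)
      rw [← hw t] at h3
      have h4 : Real.log (1 + |t / 2|) ≤ |t / 2| := log_one_add_abs_le _
      have h5 : |t / 2| ≤ |t| := by
        rw [abs_div, abs_two]
        linarith [abs_nonneg t]
      nlinarith [le_abs_self Cψ, abs_nonneg Cψ, abs_nonneg t]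
    have ht0 : (0 : ℝ) < 1 + |t| := by positivity
    have ht1 : (1 : ℝ) + |t| ≠ 0 := ht0.ne'
    calc ‖weilMellin h (1 / 2 + t * I)‖ * ‖((Complex.digamma (1 / 4 + t / 2 * I)).re : ℂ)‖
        ≤ 2 ^ 3 * S * ((1 + |t|) ^ 3)⁻¹ * ((|Cψ| + 1) * (1 + |t|)) :=
          mul_le_mul h1 h2 (norm_nonneg _) (by positivity)
      _ = 8 * S * (|Cψ| + 1) * ((1 + |t|) ^ 2)⁻¹ := by
          field_simp
          ring
      _ ≤ 8 * S * (|Cψ| + 1) * (1 + t ^ 2)⁻¹ := by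
          gcongr 8 * S * (|Cψ| + 1) * ?_
          refine inv_anti₀ (by positivity) ?_
          nlinarith [abs_nonneg t, sq_abs t]
  unfold weilArchIntegral
  calc ‖∫ t : ℝ, weilMellin h (1 / 2 + t * I) * ((Complex.digamma (1 / 4 + t / 2 * I)).re : ℂ)‖
      ≤ ∫ t : ℝ, 8 * S * (|Cψ| + 1) * (1 + t ^ 2)⁻¹ :=
        norm_integral_le_of_norm_le (integrable_inv_one_add_sq.const_mul _)
          (Eventually.of_forall hbound)
    _ = 8 * S * (|Cψ| + 1) * π := by rw [integral_const_mul, integral_univ_inv_one_add_sq]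
    _ = 8 * (|Cψ| + 1) * π * S := by ring

/-- **Continuity of the Weil functional on the window, quantitatively.** There is `c ≥ 0` such that
every Weil test `h` supported in `[-log 2, log 2]` with `sup ‖h^{(i)}‖ ≤ ε` for `i ≤ 3` has
`‖W(h)‖ ≤ c ε`: the prime term vanishes on the window, `‖ĥ(0)‖, ‖ĥ(1)‖ ≤ ∫ ‖h‖ e^{|t|/2}`,
the archimedean integral is `O(∫ ‖h‖ + ∫ ‖h'''‖)`, and `‖h(0)‖ log π ≤ ε log π`. [folklore] -/
theorem stub_extensionOfDense_weil_bound :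
    ∃ c : ℝ, 0 ≤ c ∧ ∀ h : ℝ → ℂ, IsWeilTest h →
      tsupport h ⊆ Set.Icc (-Real.log 2) (Real.log 2) →
      ∀ ε : ℝ, 0 ≤ ε → (∀ i ≤ 3, ∀ t : ℝ, ‖iteratedDeriv i h t‖ ≤ ε) →
        ‖weilFunctional h‖ ≤ c * ε := by
  obtain ⟨Cψ, hCψ⟩ :=
    Literature.Analysis.SpecialFunctions.Complex.exists_norm_digamma_vertical_le
      (a := 1 / 4) (by norm_num)
  set V : ℝ := 2 * Real.log 2 with hV
  have hV0 : 0 ≤ V := mul_nonneg zero_le_two (Real.log_nonneg one_le_two)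
  set A : ℝ := 8 * (|Cψ| + 1) * π with hA
  have hA0 : 0 ≤ A := by positivity
  refine ⟨2 * V + 2 * V + ‖(1 / (2 * π) : ℂ)‖ * (A * (V + V)) + ‖(Real.log π : ℂ)‖,
    by positivity, ?_⟩
  intro h hh hhK ε hε hder
  have hlog : -Real.log 2 ≤ Real.log 2 := by linarith [Real.log_nonneg one_le_two]
  -- the two `L¹` norms entering the archimedean bound
  have hI0 : ∫ t, ‖h t‖ ≤ ε * V := by
    have := stub_extensionOfDense_integral_iteratedDeriv_le hhK (i := 0)
      (fun t => hder 0 (Nat.zero_le _) t)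
    simpa only [iteratedDeriv_zero] using this
  have hI3 : ∫ t, ‖iteratedDeriv 3 h t‖ ≤ ε * V :=
    stub_extensionOfDense_integral_iteratedDeriv_le hhK (fun t => hder 3 le_rfl t)
  -- the weighted `L¹` norm controlling `ĥ(0)` and `ĥ(1)`
  have hL1 : weilL1 h ≤ 2 * ε * V := by
    unfold weilL1
    have e : Real.log 2 - -Real.log 2 = V := by rw [hV]; ring
    rw [← e]
    refine stub_extensionOfDense_integral_le hlog (fun t => by positivity) (fun t ht => ?_)
      (fun t ht => ?_)
    · have h1 : ‖h t‖ ≤ ε := by simpa only [iteratedDeriv_zero] using hder 0 (Nat.zero_le _) t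
      have h2 : Real.exp (|t| / 2) ≤ 2 := by
        have ht' : |t| ≤ Real.log 2 := abs_le.2 ⟨ht.1, ht.2⟩
        calc Real.exp (|t| / 2) ≤ Real.exp (Real.log 2) :=
              Real.exp_le_exp.2 (by linarith [abs_nonneg t])
          _ = 2 := Real.exp_log two_pos
      calc ‖h t‖ * Real.exp (|t| / 2) ≤ ε * 2 := mul_le_mul h1 h2 (by positivity) hε
        _ = 2 * ε := mul_comm _ _
    · have h0 : h t = 0 := image_eq_zero_of_notMem_tsupport (fun h' => ht (hhK h'))
      simp [h0]
  have hP0 : ‖weilMellin h 0‖ ≤ 2 * ε * V :=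
    (norm_weilMellin_le_weilL1 hh.1.continuous hh.2 (by simp) (by simp)).trans hL1
  have hP1 : ‖weilMellin h 1‖ ≤ 2 * ε * V :=
    (norm_weilMellin_le_weilL1 hh.1.continuous hh.2 (by simp) (by simp)).trans hL1
  -- the archimedean integral
  have hArch : ‖weilArchIntegral h‖ ≤ A * (ε * V + ε * V) := by
    refine (stub_extensionOfDense_norm_weilArchIntegral_le hCψ hh).trans ?_
    rw [hA]
    gcongr
  -- the prime term vanishes on the window
  have hPr : weilPrimeTerm h = 0 := weilPrimeTerm_eq_zero_of_tsupport_subset hh.1.continuous hhK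
  -- the point value
  have hh0 : ‖h 0‖ ≤ ε := by simpa only [iteratedDeriv_zero] using hder 0 (Nat.zero_le _) 0
  -- assemble
  unfold weilFunctional weilPolarTerm weilArchTerm
  rw [hPr, sub_zero]
  calc ‖weilMellin h 0 + weilMellin h 1 +
          ((1 / (2 * π) : ℂ) * weilArchIntegral h - h 0 * (Real.log π : ℂ))‖
      ≤ ‖weilMellin h 0‖ + ‖weilMellin h 1‖ +
          (‖(1 / (2 * π) : ℂ)‖ * ‖weilArchIntegral h‖ + ‖h 0‖ * ‖(Real.log π : ℂ)‖) := by
        refine (norm_add_le _ _).trans (add_le_add (norm_add_le _ _) ?_)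
        refine (norm_sub_le _ _).trans (add_le_add ?_ ?_) <;> rw [norm_mul]
    _ ≤ 2 * ε * V + 2 * ε * V +
          (‖(1 / (2 * π) : ℂ)‖ * (A * (ε * V + ε * V)) + ε * ‖(Real.log π : ℂ)‖) := by
        gcongr
    _ = (2 * V + 2 * V + ‖(1 / (2 * π) : ℂ)‖ * (A * (V + V)) + ‖(Real.log π : ℂ)‖) * ε := by
        ring

/-! ## The stub -/

/-- **stub_extensionOfDense — continuity of both sides: exactness on a dense family is exactness on
the window, given domination.** Let `gⱼ` be a family of Weil tests supported in
`K = [-log 2, log 2]`, dense in every `C^k` sup-seminorm among the Weil tests supported in `K`; let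
`x` be a poly-profile configuration, `|δ n| ≤ D`, and suppose `n ↦ x n + δ n` reproduces `W(gⱼ)` for
every `j`. Then it reproduces `W(f)` for every Weil test `f` supported in `K`. Proof: with
`h = f - gⱼ`, the spectral side satisfies `‖Σₙ ĥ(1/2 + i(xₙ + δₙ))‖ ≤ |K| (∫‖h‖ + ∫‖h^{(k)}‖)`
(domination) and the Weil side `‖W(h)‖ ≤ c · sup_{i ≤ 3} ‖h^{(i)}‖_∞`
(`stub_extensionOfDense_weil_bound`); both are `O(ε)` for `gⱼ` `ε`-close to `f` in `C^{max k 3}`,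
and they agree on `gⱼ`; so `Σₙ f̂(1/2 + i(xₙ + δₙ)) = W(f)`, a `HasSum` by absolute convergence.
[folklore] -/
theorem stub_extensionOfDense :
    (∀ (x : ℕ → ℝ) (C D : ℝ) (N : ℕ),
      (∀ (T : ℝ) (s : Finset ℕ), (∀ n ∈ s, |x n - T| ≤ 1) → (s.card : ℝ) ≤ C * (1 + |T|) ^ N) →
      ∃ (K : ℝ) (k : ℕ), ∀ f : ℝ → ℂ, Literature.NumberTheory.LFunctions.IsWeilTest f →
        ∃ b : ℕ → ℝ, Summable b ∧
          (∀ (n : ℕ) (v : ℝ), |v| ≤ D →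
            ‖Literature.NumberTheory.LFunctions.weilMellin f (1 / 2 + ((x n + v : ℝ) : ℂ) * Complex.I)‖ ≤ b n) ∧
          ∑' n, b n ≤ K * ((∫ t, ‖f t‖) + ∫ t, ‖iteratedDeriv k f t‖)) →
    ∀ g : ℕ → ℝ → ℂ,
      ((∀ j, Literature.NumberTheory.LFunctions.IsWeilTest (g j) ∧ tsupport (g j) ⊆ Set.Icc (-Real.log 2) (Real.log 2)) ∧
        ∀ f : ℝ → ℂ, Literature.NumberTheory.LFunctions.IsWeilTest f → tsupport f ⊆ Set.Icc (-Real.log 2) (Real.log 2) →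
          ∀ (k : ℕ) (ε : ℝ), 0 < ε → ∃ j, ∀ i ≤ k, ∀ t : ℝ, ‖iteratedDeriv i (f - g j) t‖ ≤ ε) →
      ∀ (x : ℕ → ℝ) (C D : ℝ) (N : ℕ) (δ : ℕ → ℝ),
        (∀ (T : ℝ) (s : Finset ℕ), (∀ n ∈ s, |x n - T| ≤ 1) → (s.card : ℝ) ≤ C * (1 + |T|) ^ N) →
        (∀ n, |δ n| ≤ D) →
        (∀ j, HasSum (fun n => Literature.NumberTheory.LFunctions.weilMellin (g j) (1 / 2 + ((x n + δ n : ℝ) : ℂ) * Complex.I))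
          (Literature.NumberTheory.LFunctions.weilFunctional (g j))) →
        ∀ f : ℝ → ℂ, Literature.NumberTheory.LFunctions.IsWeilTest f → tsupport f ⊆ Set.Icc (-Real.log 2) (Real.log 2) →
          HasSum (fun n => Literature.NumberTheory.LFunctions.weilMellin f (1 / 2 + ((x n + δ n : ℝ) : ℂ) * Complex.I))
            (Literature.NumberTheory.LFunctions.weilFunctional f) := by
  intro hdom g hg x C D N δ hP hδ hex f hf hfK
  obtain ⟨K₀, k₀, hK⟩ := hdom x C D N hP
  obtain ⟨c, hc0, hc⟩ := stub_extensionOfDense_weil_bound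
  -- spectral side: absolute convergence and the domination bound, for every Weil test
  have hspec : ∀ h : ℝ → ℂ, IsWeilTest h →
      Summable (fun n => weilMellin h (1 / 2 + ((x n + δ n : ℝ) : ℂ) * I)) ∧
      ‖∑' n, weilMellin h (1 / 2 + ((x n + δ n : ℝ) : ℂ) * I)‖ ≤
        |K₀| * ((∫ t, ‖h t‖) + ∫ t, ‖iteratedDeriv k₀ h t‖) := by
    intro h hh
    obtain ⟨b, hb, hbd, hbK⟩ := hK h hh
    have hpt : ∀ n, ‖weilMellin h (1 / 2 + ((x n + δ n : ℝ) : ℂ) * I)‖ ≤ b n := fun n =>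
      hbd n (δ n) (hδ n)
    refine ⟨Summable.of_norm_bounded hb hpt,
      (tsum_of_norm_bounded hb.hasSum hpt).trans (hbK.trans ?_)⟩
    have hS : 0 ≤ (∫ t, ‖h t‖) + ∫ t, ‖iteratedDeriv k₀ h t‖ :=
      add_nonneg (integral_nonneg fun _ => norm_nonneg _) (integral_nonneg fun _ => norm_nonneg _)
    exact mul_le_mul_of_nonneg_right (le_abs_self K₀) hS
  -- it suffices to identify the sum of the (absolutely convergent) series
  obtain ⟨hfsum, -⟩ := hspec f hf
  suffices heq : ∑' n, weilMellin f (1 / 2 + ((x n + δ n : ℝ) : ℂ) * I) = weilFunctional f by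
    rw [← heq]
    exact hfsum.hasSum
  set V : ℝ := 2 * Real.log 2 with hV
  have hV0 : 0 ≤ V := mul_nonneg zero_le_two (Real.log_nonneg one_le_two)
  set A : ℝ := |K₀| * (V + V) + c with hA
  have hA0 : 0 ≤ A := by positivity
  -- approximation through the dense family
  have key : ∀ ε : ℝ, 0 < ε →
      ‖∑' n, weilMellin f (1 / 2 + ((x n + δ n : ℝ) : ℂ) * I) - weilFunctional f‖ ≤ A * ε := by
    intro ε hε
    obtain ⟨j, hj⟩ := hg.2 f hf hfK (max k₀ 3) ε hε
    obtain ⟨hgj, hgjK⟩ := hg.1 j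
    set h : ℝ → ℂ := f - g j with hh_def
    have hh : IsWeilTest h := ⟨hf.1.sub hgj.1, hf.2.sub hgj.2⟩
    have hhK : tsupport h ⊆ Set.Icc (-Real.log 2) (Real.log 2) :=
      (tsupport_sub f (g j)).trans (union_subset hfK hgjK)
    -- linearity of both sides
    have hMf : ∀ s, weilMellin f s = weilMellin h s + weilMellin (g j) s := fun s => by
      rw [← weilMellin_add hh.1.continuous hh.2 hgj.1.continuous hgj.2, hh_def, sub_add_cancel]
    have hWf : weilFunctional f = weilFunctional h + weilFunctional (g j) := by
      rw [← weilFunctional_add hh hgj, hh_def, sub_add_cancel]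
    obtain ⟨hhsum, hhbound⟩ := hspec h hh
    have hsumf : HasSum (fun n => weilMellin f (1 / 2 + ((x n + δ n : ℝ) : ℂ) * I))
        (∑' n, weilMellin h (1 / 2 + ((x n + δ n : ℝ) : ℂ) * I) + weilFunctional (g j)) := by
      have := hhsum.hasSum.add (hex j)
      simpa only [← hMf] using this
    have hdiff : ∑' n, weilMellin f (1 / 2 + ((x n + δ n : ℝ) : ℂ) * I) - weilFunctional f =
        ∑' n, weilMellin h (1 / 2 + ((x n + δ n : ℝ) : ℂ) * I) - weilFunctional h := by
      rw [hsumf.tsum_eq, hWf]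
      ring
    rw [hdiff]
    -- smallness of `h`
    have hI0 : ∫ t, ‖h t‖ ≤ ε * V := by
      have := stub_extensionOfDense_integral_iteratedDeriv_le hhK (i := 0)
        (fun t => hj 0 (Nat.zero_le _) t)
      simpa only [iteratedDeriv_zero] using this
    have hIk : ∫ t, ‖iteratedDeriv k₀ h t‖ ≤ ε * V :=
      stub_extensionOfDense_integral_iteratedDeriv_le hhK (fun t => hj k₀ (le_max_left _ _) t)
    have hW : ‖weilFunctional h‖ ≤ c * ε :=
      hc h hh hhK ε hε.le (fun i hi t => hj i (hi.trans (le_max_right _ _)) t)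
    calc ‖∑' n, weilMellin h (1 / 2 + ((x n + δ n : ℝ) : ℂ) * I) - weilFunctional h‖
        ≤ ‖∑' n, weilMellin h (1 / 2 + ((x n + δ n : ℝ) : ℂ) * I)‖ + ‖weilFunctional h‖ :=
          norm_sub_le _ _
      _ ≤ |K₀| * (ε * V + ε * V) + c * ε := add_le_add (hhbound.trans (by gcongr)) hW
      _ = A * ε := by rw [hA]; ring
  -- conclusion: the two sides are arbitrarily close
  refine eq_of_forall_dist_le fun η hη => ?_
  rw [dist_eq_norm]
  have hAη : A * (η / (A + 1)) ≤ η := by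
    rw [mul_div_assoc', div_le_iff₀ (by positivity)]
    nlinarith
  exact (key (η / (A + 1)) (by positivity)).trans hAη

end Summit.RiemannHypothesis.RiemannHypothesis.Theorems.SpectralTraceWindowTraceArch

end
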